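import Summits.AtomisticToContinuum.FouriersLaw.Theses.CurrentTiltQuench

/-!
# `CurrentTiltQuench.BridgeGlue` (stmt-AtomisticToContinuum-9190) — proved

`BridgeGlue : UniformQuadraticResponse → QuenchCurrentDies → BoundedOddRigidity → NoTruncatedDrude` is pure logic plus the
real-number step `|εX| ≤ |Y − εX| + |Y|` with `ε = min(ε₀, η/(2(|K|+1)))`, `δ = εη/2` (the `hbridge` block of the route's deciding
theorem `CurrentTiltQuench.closes`, extracted verbatim as a standalone theorem so that the support item stmt-9190 can be closed and
the bridge can be COMPOSED with other routes' reductions).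

Used by `Theorems/JunctionLocalityNonBallisticOfCurrentTiltQuenchCruxes.lean` (lead c4 of crux stmt-9127) to compose the bridge with the
landed deciding reduction `(K) → NoTruncatedDrude → NonBallistic` (p156168). No definitions; candidate proofs of the same statement were
attached to stmt-9190 by refuters g42-14 / g41-42 / g41-18 (2026-08-15) — this is the landing.
-/

namespace Summit.AtomisticToContinuum.FouriersLaw.Theorems.CurrentTiltQuench

open Summit.AtomisticToContinuum.FouriersLaw.Theses.CurrentTiltQuench

/-- **`BridgeGlue` (stmt-AtomisticToContinuum-9190).** `UniformQuadraticResponse → QuenchCurrentDies → BoundedOddRigidity →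
NoTruncatedDrude`: given `η > 0`, take `ε = min(ε₀, η/(2(|K|+1)))` in the uniform quadratic response bound and `δ = εη/2` in the
decay of the averaged quench current (whose rigidity premise is `BoundedOddRigidity` at the clip level `M`); then
`ε|A_M(L,τ)| ≤ |Y − εA| + |Y| ≤ Kε² + εη/2`, so `|A_M(L,τ)| ≤ Kε + η/2 ≤ η` for `τ ≥ max τ₀ 1`, `L ≥ max L₁ L₂`. [folklore] -/
theorem bridgeGlue_proof : Summit.AtomisticToContinuum.FouriersLaw.Theses.CurrentTiltQuench.BridgeGlue := by
  intro hU hQ hB ω₂ lam β γ hω hl hβ T hT μ hGibbs hS hR D hPres hCov M hM F hF η hη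
  obtain ⟨ε₀, hε₀, K, hK⟩ := hU ω₂ lam β γ hω hl hβ T hT μ hGibbs hS hR D hPres hCov M hM F hF
  have hrig : ∀ ν : MeasureTheory.Measure Literature.MathematicalPhysics.KineticTheory.HeatConduction.ChainConfig,
      MeasureTheory.IsProbabilityMeasure ν → Literature.MathematicalPhysics.KineticTheory.HeatConduction.IsShiftInvariant ν →
      Literature.MathematicalPhysics.KineticTheory.HeatConduction.IsTimeInvariant (Literature.MathematicalPhysics.KineticTheory.HeatConduction.pinnedChain ω₂ lam β γ) ν →
      Literature.MathematicalPhysics.KineticTheory.HeatConduction.IsRegular (Literature.MathematicalPhysics.KineticTheory.HeatConduction.pinnedChain ω₂ lam β γ) ν →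
      ∫ σ, F ((Literature.MathematicalPhysics.KineticTheory.HeatConduction.pinnedChain ω₂ lam β γ).bondCurrentZ σ 0) ∂ν = 0 := by
    intro ν h1 h2 h3 h4
    subst hF
    exact hB ω₂ lam β γ hω hl hβ ν h1 h2 h3 h4 M hM
  set ε : ℝ := min ε₀ (η / (2 * (|K| + 1))) with hεdef
  have hKpos : 0 < |K| + 1 := by positivity
  have hεpos : 0 < ε := lt_min hε₀ (by positivity)
  have hεle : ε ≤ ε₀ := min_le_left _ _
  have hεle' : ε ≤ η / (2 * (|K| + 1)) := min_le_right _ _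
  obtain ⟨τ₀, hτ₀⟩ := hQ ω₂ lam β γ hω hl hβ T hT μ hGibbs hS hR D hPres hCov M hM F hF hrig ε hεpos (ε * η / 2)
    (by positivity)
  refine ⟨max τ₀ 1, fun τ hτ => ?_⟩
  obtain ⟨L₁, hL₁⟩ := hτ₀ τ (le_of_max_le_left hτ)
  obtain ⟨L₂, hL₂⟩ := hK ε hεpos hεle τ (le_of_max_le_right hτ)
  refine ⟨max L₁ L₂, fun L hL G hG => ?_⟩
  have h1 := hL₁ L (le_of_max_le_left hL) G hG
  have h2 := hL₂ L (le_of_max_le_right hL) G hG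
  generalize hX : (τ⁻¹ * ∫ t in (0:ℝ)..τ, ((∫ σ, F ((Literature.MathematicalPhysics.KineticTheory.HeatConduction.pinnedChain ω₂ lam β γ).bondCurrentZ (D.flow t σ) 0) * G σ ∂μ) - (∫ σ, F ((Literature.MathematicalPhysics.KineticTheory.HeatConduction.pinnedChain ω₂ lam β γ).bondCurrentZ (D.flow t σ) 0) ∂μ) * (∫ σ, G σ ∂μ))) = X at h2 ⊢
  generalize hYY : (τ⁻¹ * ∫ t in (0:ℝ)..τ, ((∫ σ, F ((Literature.MathematicalPhysics.KineticTheory.HeatConduction.pinnedChain ω₂ lam β γ).bondCurrentZ (D.flow t σ) 0) * Real.exp (ε * G σ) ∂μ) / (∫ σ, Real.exp (ε * G σ) ∂μ) - ∫ σ, F ((Literature.MathematicalPhysics.KineticTheory.HeatConduction.pinnedChain ω₂ lam β γ).bondCurrentZ (D.flow t σ) 0) ∂μ)) = Y at h1 h2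
  have h3 : ε * |X| ≤ K * ε ^ 2 + ε * η / 2 := by
    have : |ε * X| ≤ |Y - ε * X| + |Y| := by
      calc |ε * X| = |Y - (Y - ε * X)| := by ring_nf
        _ ≤ |Y| + |Y - ε * X| := abs_sub _ _
        _ = |Y - ε * X| + |Y| := by ring
    rw [abs_mul, abs_of_pos hεpos] at this
    linarith
  have h4 : |X| ≤ K * ε + η / 2 := by
    have h3' : ε * |X| ≤ ε * (K * ε + η / 2) := by
      calc ε * |X| ≤ K * ε ^ 2 + ε * η / 2 := h3
        _ = ε * (K * ε + η / 2) := by ring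
    exact le_of_mul_le_mul_left h3' hεpos
  have h5 : K * ε ≤ η / 2 := by
    have hK1 : K * ε ≤ |K| * (η / (2 * (|K| + 1))) :=
      (mul_le_mul_of_nonneg_right (le_abs_self K) hεpos.le).trans (mul_le_mul_of_nonneg_left hεle' (abs_nonneg K))
    have hK2 : |K| * (η / (2 * (|K| + 1))) ≤ η / 2 := by
      rw [← mul_div_assoc, div_le_iff₀ (by positivity : (0:ℝ) < 2 * (|K| + 1))]
      have : η / 2 * (2 * (|K| + 1)) = |K| * η + η := by ring
      rw [this]
      linarith
    linarith
  linarith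

end Summit.AtomisticToContinuum.FouriersLaw.Theorems.CurrentTiltQuench
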